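import Mathlib
import Summits.Ventures.HodgeRepro2.T5CoframeInvariance

/-!
# T5CoframeAction — a change of coframe acts on the six coefficients of a 2-covector by `Λ²g`

Tier-5 support for sub-step N1 (Hodge-theoretic side; memo route/T5-N1-hodge-p6.md §H1–H2):
`T5CoframeInvariance` proved that `Λ²g` (the matrix of `2 × 2` minors) is orthogonal for
`g ∈ O(4)`, leaving as prose «that a change of orthonormal coframe acts on the six coefficients
by `Λ²g`».  This file supplies that sentence:

* a real 2-covector on `ℝ⁴` is an antisymmetric `4 × 4` matrix `B` (`B i j = B(e_i, e_j)`), its six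
  coefficients are `coeff B I = B (pairs I).1 (pairs I).2`;
* the pull-back of `B` by the linear map `u ↦ g u` is `gᵀ B g` (`pull`), and `coeff_pull`: its
  coefficients are `(Λ²g)ᵀ *ᵥ coeff B` — the six coefficients transform by the compound matrix;
* `dotProduct_coeff_pull`: for `g` orthogonal the inner product of the coefficient vectors is
  unchanged — the pointwise metric on 2-forms of Voisin (5.1) is the same for every orthonormal
  coframe (the statement announced in `T5CoframeInvariance`, now with the action made explicit).

Blind lane (cell pub-hodge-repro2): `import Mathlib` + own `T5CoframeInvariance`, 0 sorry,
standard axioms.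
-/

namespace Summit.Ventures.HodgeRepro2.T5CoframeAction

open Matrix Summit.Ventures.HodgeRepro2.T5CoframeInvariance

/-- The six coefficients `B(e_i, e_j)`, `i < j`, of an antisymmetric matrix `B` (a real 2-covector
on `ℝ⁴` in the coframe `e^*_1, …, e^*_4`), in the order of `pairs`. -/
def coeff (B : Matrix (Fin 4) (Fin 4) ℝ) : Fin 6 → ℝ :=
  fun I => B (pairs I).1 (pairs I).2

/-- The pull-back of the bilinear form `B` by the linear map `u ↦ g *ᵥ u`:
`(g^*B)(e_i, e_j) = B(g e_i, g e_j) = Σ_{k,l} g_{ki} B_{kl} g_{lj} = (gᵀ B g)_{ij}`. -/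
def pull (g B : Matrix (Fin 4) (Fin 4) ℝ) : Matrix (Fin 4) (Fin 4) ℝ :=
  gᵀ * B * g

/-- Entries of the pull-back. -/
theorem pull_apply (g B : Matrix (Fin 4) (Fin 4) ℝ) (i j : Fin 4) :
    pull g B i j = ∑ k, ∑ l, g k i * B k l * g l j := by
  simp only [pull, Matrix.mul_apply, Matrix.transpose_apply, Finset.sum_mul]
  exact Finset.sum_comm

/-- The pull-back of an antisymmetric matrix is antisymmetric. -/
theorem pull_transpose (g B : Matrix (Fin 4) (Fin 4) ℝ) (hB : Bᵀ = -B) :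
    (pull g B)ᵀ = -pull g B := by
  simp only [pull, Matrix.transpose_mul, Matrix.transpose_transpose, hB, Matrix.mul_assoc,
    Matrix.neg_mul, Matrix.mul_neg]

/-- The coefficients of the pull-back are the compound matrix applied to the coefficients:
`coeff (g^*B) = (Λ²g)ᵀ *ᵥ coeff B`, i.e. `(g^*B)(e_{i₁}, e_{i₂}) = Σ_{K} minor g K I · B(e_{k₁}, e_{k₂})`
— a change of coframe acts on the six coefficients by `Λ²g`. -/
theorem coeff_pull (g B : Matrix (Fin 4) (Fin 4) ℝ) (hB : Bᵀ = -B) :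
    coeff (pull g B) = (compound g)ᵀ *ᵥ coeff B := by
  have hB' : ∀ i j, B j i = -B i j := fun i j => by
    have := congrFun (congrFun hB i) j
    simpa [Matrix.transpose_apply] using this
  have h00 : B 0 0 = 0 := by have := hB' 0 0; linarith
  have h11 : B 1 1 = 0 := by have := hB' 1 1; linarith
  have h22 : B 2 2 = 0 := by have := hB' 2 2; linarith
  have h33 : B 3 3 = 0 := by have := hB' 3 3; linarith
  have h10 := hB' 0 1
  have h20 := hB' 0 2
  have h30 := hB' 0 3
  have h21 := hB' 1 2
  have h31 := hB' 1 3
  have h32 := hB' 2 3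
  funext I
  fin_cases I <;>
    simp [coeff, pairs, pull_apply, compound, minor, Matrix.mulVec, dotProduct,
      Matrix.transpose_apply, Fin.sum_univ_four, Fin.sum_univ_six, h00, h11, h22, h33,
      h10, h20, h30, h21, h31, h32] <;> ring

/-- For an orthogonal change of coframe the inner product of the coefficient vectors of two
2-covectors is unchanged: the metric `(,)_s` on `Λ²T^*_sS` defined from an orthonormal coframe
(Voisin p0104 l. 7) does not depend on the coframe. -/
theorem dotProduct_coeff_pull {g : Matrix (Fin 4) (Fin 4) ℝ} (hg : gᵀ * g = 1)
    {B B' : Matrix (Fin 4) (Fin 4) ℝ} (hB : Bᵀ = -B) (hB' : B'ᵀ = -B') :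
    coeff (pull g B) ⬝ᵥ coeff (pull g B') = coeff B ⬝ᵥ coeff B' := by
  rw [coeff_pull g B hB, coeff_pull g B' hB', ← compound_transpose]
  have hgT : gᵀᵀ * gᵀ = 1 := by
    rw [Matrix.transpose_transpose]
    exact mul_eq_one_comm.mp hg
  exact dotProduct_compound_mulVec hgT _ _

/-- In particular the norm-squared of a 2-covector's coefficient vector is coframe-independent. -/
theorem dotProduct_self_coeff_pull {g : Matrix (Fin 4) (Fin 4) ℝ} (hg : gᵀ * g = 1)
    {B : Matrix (Fin 4) (Fin 4) ℝ} (hB : Bᵀ = -B) :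
    coeff (pull g B) ⬝ᵥ coeff (pull g B) = coeff B ⬝ᵥ coeff B :=
  dotProduct_coeff_pull hg hB hB

end Summit.Ventures.HodgeRepro2.T5CoframeAction
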